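import Literature.AlgebraicGeometry.Motives.HodgeThetaSubalgebraUnitaryFourTwoLeviData
import Literature.AlgebraicGeometry.Motives.HodgeThetaSubalgebraUnitaryFourTwoLeviLines
import Literature.AlgebraicGeometry.Motives.HodgeThetaSubalgebraUnitaryFourTwoLeviCentraliser
import Literature.Algebra.Lie.IrreducibleLinearLieAlgebraPlane
import HarnessLib

/-!
# The `Θ`-subalgebra theorem beyond coprime multiplicities, V: the TENSOR SKELETON of a `P`-annihilator-reducible
# `𝔊 ∋ 1, Θ` at multiplicities `(2,4)` — `3 × 3` matrix units `fᵢgⱼ ∈ 𝔊` with `2`-dimensional diagonal blocks and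
# `𝔊 = 𝔠 + Σ ℂ·fᵢgⱼ`, `𝔠` the centraliser acting on a block through all of `𝔤𝔩₂`
# (Moonen–Zarhin 1999 (2.5) `𝔤𝔩₂ ⊗ 1 + 1 ⊗ 𝔤𝔩₃` on `ℂ² ⊗ ℂ³`; Ribet 1983 Thm. 3 Lie step; classification-free)

Family `hodge`, layer `Literature/AlgebraicGeometry/Motives` (pure complex linear algebra; no geometry). Written for the cell
`pub-hodgeav-hg6` (req-37 (A) row 2 «base of HC ladder», TABLE X row 8-`(4,2)`, crux `UnitaryThetaCore.top_or_radical_two_four`;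
eng-5 lineage g5, brick V3; honest framing of that cell: HC / HC_AV / HC_CM / H2 NOT proved — THIS file is unconditional linear
algebra and discharges no hypothesis of the cell's cover). UNCONDITIONAL; theorems only — no definition, no named fact (D-0026),
no `sorry`. It assembles bricks V2a (`UnitaryFourTwo.exists_levi_data`), V2b (`UnitaryFourTwo.lines_of_annP_reducible`), V2c
(`UnitaryFourTwo.levi_decomposition`, `UnitaryFourTwo.centraliser_irreducible`) and the tree's relative plane theorem
`Literature.Algebra.Lie.exists_mem_forall_eq_of_trace_eq_zero` (lit-hodgefound).

SETTING. `W` finite-dimensional over `ℂ`; `𝔊 ⊆ End(W)` closed under the commutator, irreducible, `1, Θ ∈ 𝔊`, `Θ² = 1`,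
`dim P = 2`, `dim Q = 4` (`P = {Θ = 1}`, `Q = {Θ = −1}`), and a subspace `0 ≠ U₀ ≠ Q` of `Q` stable under the
`P`-annihilator ideal `𝔑 = {X ∈ 𝔊 : XΘ = ΘX, X(P) = 0}` (the branch complementary to brick V1).

WHAT IS PROVED.
* §1 **`UnitaryFourTwo.lower_mul_raise_scalar`**, **`UnitaryFourTwo.lower_mul_raise_scalar'`** — with the Levi decomposition
  of brick V2c: for a raising `n ∈ 𝔊` with `n = nE₁` and a lowering `C ∈ 𝔊` with `C = E₁C`, `Cn` is a SCALAR multiple of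
  `E₁` (evaluate `[n, C] = aU + bV + y(E₁ − E₂) + S` against `E₂` and `E₁`); symmetrically `me` for a lowering
  `m = E₁m` and raising `e = eE₁`.
* §2 **`UnitaryFourTwo.exists_matrix_units`** — THE TENSOR SKELETON: there are `e, C, E₁, E₂, U, V ∈ 𝔊` with the
  `3 × 3` MATRIX-UNIT RELATIONS for `f = (e, E₁, V)`, `g = (C, E₁, U)` (`gⱼfₖ = δⱼₖE₁`, `fᵢE₁ = fᵢ`, `E₁gⱼ = gⱼ`,
  `eC + E₁ + VU = 1`, all `fᵢgⱼ ∈ 𝔊`, `rank E₁ = 2`), the involution `Θ = eC − E₁ − E₂`, the DECOMPOSITION of every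
  `X ∈ 𝔊` as `S + Σ cᵢⱼ fᵢgⱼ` with `S ∈ 𝔊` commuting with `e, C, E₁, U, V`, and FULLNESS: every `2 × 2` block `E₁yE₁`
  is the block of such a centraliser element `S ∈ 𝔊` (`W ≅ range E₁ ⊗ ℂ³`, `𝔊 = 𝔤𝔩(range E₁) ⊗ 1 + 1 ⊗ 𝔤𝔩₃`).
SEQUEL: brick V4 computes, from these relations alone, the radical of `tr_W − ¾κ` on `[𝔊, 𝔊]` (`= 𝔰𝔩₂ ⊗ 1`, commuting
with `Θ`); brick V5 assembles `UnitaryThetaCore.top_or_radical_two_four`.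

## References
* [MoonenZarhin1999LowDim] B. Moonen, Yu. Zarhin, Math. Ann. 315 (1999), §2 (2.5), Thm. (2.7).
* [Ribet1983] K. A. Ribet, Amer. J. Math. 105 (1983), Thm. 3.
* [Tankeev1996] S. G. Tankeev, Izv. Math. 60 (1996) 391–424.
* [GoodmanWallachGTM255] R. Goodman, N. Wallach, *Symmetry, Representations, and Invariants*, §4.1.1.
* [Humphreys1972] J. E. Humphreys, *Introduction to Lie Algebras and Representation Theory*, §4.1, §19.1.
-/

noncomputable section

open Module

namespace Literature.AlgebraicGeometry.Motives

namespace HodgeStructure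

variable {W : Type*} [AddCommGroup W] [Module ℂ W]

/-! ### §1 `Cn` and `me` are scalars on the middle block -/

section Scalars

/-- **`C n ∈ ℂE₁`** for a raising `n = nE₁ ∈ 𝔊` and a lowering `C = E₁C ∈ 𝔊` (SETTING of brick V2c:
`E₁, E₂, U, V ∈ 𝔊` unit pair and lines). Write `[n, C] = aU + bV + y(E₁ − E₂) + S` by
`UnitaryFourTwo.levi_decomposition`; right multiplication by `E₂` gives `aU = 0`, `SE₂ = yE₂` (so `SE₁ = yE₁`), and by `E₁`
gives `−Cn = bV + 2yE₁`, whence `Cn = −2yE₁`. [cite: MoonenZarhin1999LowDim, §2 (2.5)] [cite: Ribet1983, Thm. 3] -/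
theorem UnitaryFourTwo.lower_mul_raise_scalar {𝔊 : Submodule ℂ (Module.End ℂ W)}
    (hbr : ∀ Y ∈ 𝔊, ∀ Z ∈ 𝔊, Y * Z - Z * Y ∈ 𝔊) {Θ E₁ E₂ U V : Module.End ℂ W}
    (hE₁ : E₁ ∈ 𝔊) (hE₂ : E₂ ∈ 𝔊) (hU : U ∈ 𝔊) (hV : V ∈ 𝔊) (hE₁0 : E₁ ≠ 0)
    (hsum : E₁ + E₂ = (2 : ℂ)⁻¹ • (1 - Θ)) (hE₁E₁ : E₁ * E₁ = E₁) (hE₂E₂ : E₂ * E₂ = E₂) (hE₁E₂ : E₁ * E₂ = 0)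
    (hE₂E₁ : E₂ * E₁ = 0) (hE₁Θ : E₁ * Θ = Θ * E₁) (hE₂Θ : E₂ * Θ = Θ * E₂) (hUΘ : U * Θ = Θ * U)
    (hVΘ : V * Θ = Θ * V) (hE₁U : E₁ * U = U) (hUE₂ : U * E₂ = U) (hE₂V : E₂ * V = V) (hVE₁ : V * E₁ = V)
    (hUV : U * V = E₁) (hVU : V * U = E₂)
    (hlineU : ∀ X ∈ 𝔊, X * Θ = Θ * X → ∃ c : ℂ, E₁ * X * E₂ = c • U)
    (hlineV : ∀ X ∈ 𝔊, X * Θ = Θ * X → ∃ c : ℂ, E₂ * X * E₁ = c • V)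
    (hgraded : ∀ X ∈ 𝔊, X * Θ = Θ * X →
      E₁ * X * E₂ ∈ 𝔊 ∧ E₂ * X * E₁ ∈ 𝔊 ∧ (X - E₁ * X * E₂ - E₂ * X * E₁) * E₂ = E₂ * (X - E₁ * X * E₂ - E₂ * X * E₁))
    {C n : Module.End ℂ W} (hC : C ∈ 𝔊) (hΘC : Θ * C = -C) (hCΘ : C * Θ = C) (hE₁C : E₁ * C = C)
    (hn : n ∈ 𝔊) (hΘn : Θ * n = n) (hnΘ : n * Θ = -n) (hnE₁ : n * E₁ = n) :
    ∃ c : ℂ, C * n = c • E₁ := by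
  -- `C` kills `E₁, E₂`; `E₁, E₂` kill `n`
  have hCπ : C * (E₁ + E₂) = 0 := by
    rw [hsum, mul_smul_comm, mul_sub, mul_one, hCΘ, sub_self, smul_zero]
  have hCE₁ : C * E₁ = 0 := by
    have h : C * E₁ = C * (E₁ + E₂) * E₁ := by rw [mul_add, add_mul, mul_assoc C E₂ E₁, hE₂E₁, mul_zero, add_zero,
      mul_assoc, hE₁E₁]
    rw [h, hCπ, zero_mul]
  have hCE₂ : C * E₂ = 0 := by
    have h : C * E₂ = C * (E₁ + E₂) * E₂ := by rw [mul_add, add_mul, mul_assoc C E₁ E₂, hE₁E₂, mul_zero, zero_add,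
      mul_assoc, hE₂E₂]
    rw [h, hCπ, zero_mul]
  have hπn : (E₁ + E₂) * n = 0 := by
    rw [hsum, smul_mul_assoc, sub_mul, one_mul, hΘn, sub_self, smul_zero]
  have hnE₂ : n * E₂ = 0 := by rw [← hnE₁, mul_assoc, hE₁E₂, mul_zero]
  -- the bracket `D = nC − Cn` commutes with `Θ`
  have hD : n * C - C * n ∈ 𝔊 := hbr n hn C hC
  have hDΘ : (n * C - C * n) * Θ = Θ * (n * C - C * n) := by
    rw [sub_mul, mul_sub, mul_assoc, hCΘ, ← mul_assoc, hΘn, mul_assoc, hnΘ, mul_neg, ← mul_assoc, hΘC, neg_mul]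
  obtain ⟨a, b, y, S, hS, hDeq, hSΘ, hSE₂, hSU, hSV⟩ := UnitaryFourTwo.levi_decomposition hbr hE₁ hE₂ hU hV hE₁0 hsum
    hE₁E₁ hE₂E₂ hE₁E₂ hE₂E₁ hE₁Θ hE₂Θ hUΘ hVΘ hE₁U hUE₂ hE₂V hVE₁ hUV hVU hlineU hlineV hgraded hD hDΘ
  have hUE₁ : U * E₁ = 0 := by rw [← hUE₂, mul_assoc, hE₂E₁, mul_zero]
  have hVE₂ : V * E₂ = 0 := by rw [← hVE₁, mul_assoc, hE₁E₂, mul_zero]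
  have hE₁V : E₁ * V = 0 := by rw [← hE₂V, ← mul_assoc, hE₁E₂, zero_mul]
  have hSE₁ : S * E₁ = y • E₁ := by
    -- `SE₂ = yE₂` from `D E₂ = 0`, then `SE₁ = SUV = U(SE₂)E₂... = yE₁` via `U S V = U V S`
    have hDE₂ : (n * C - C * n) * E₂ = 0 := by rw [sub_mul, mul_assoc, hCE₂, mul_zero, mul_assoc, hnE₂, mul_zero, sub_self]
    rw [hDeq] at hDE₂
    have h2 : a • U - y • E₂ + S * E₂ = 0 := by
      have h := hDE₂
      rw [add_mul, add_mul, add_mul, smul_mul_assoc, smul_mul_assoc, smul_mul_assoc, hUE₂, hVE₂, smul_zero, add_zero,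
        sub_mul, hE₁E₂, hE₂E₂, zero_sub, smul_neg] at h
      rw [← h]; abel
    have haU : a • U = 0 := by
      have h := congrArg (fun F => E₁ * F) h2
      simp only [mul_add, mul_sub, mul_smul_comm, hE₁U, hE₁E₂, smul_zero, sub_zero, mul_zero] at h
      -- h : a • U + E₁ * (S * E₂) = 0 ; and E₁ S E₂ = S E₁ E₂ = 0
      have hSE₁c : S * E₁ = E₁ * S := by
        have h' : S * (E₁ + E₂) = (E₁ + E₂) * S := by
          rw [hsum, mul_smul_comm, smul_mul_assoc, mul_sub, sub_mul, mul_one, one_mul, hSΘ]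
        rw [mul_add, add_mul, hSE₂] at h'
        exact add_right_cancel h'
      rw [← mul_assoc, ← hSE₁c, mul_assoc, hE₁E₂, mul_zero, add_zero] at h
      exact h
    have hSE₂' : S * E₂ = y • E₂ := by
      rw [haU, zero_sub, neg_add_eq_zero] at h2
      exact h2.symm
    calc S * E₁ = S * (U * V) := by rw [hUV]
      _ = U * (S * (E₂ * V)) := by rw [← mul_assoc, hSU, mul_assoc, hE₂V]
      _ = y • E₁ := by rw [← mul_assoc S, hSE₂', smul_mul_assoc, hE₂V, mul_smul_comm, hUV]
  -- `D E₁ = −Cn = bV + 2yE₁`, and `E₁` on the left kills `V`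
  have hDE₁ : (n * C - C * n) * E₁ = -(C * n) := by rw [sub_mul, mul_assoc, hCE₁, mul_zero, zero_sub, mul_assoc, hnE₁]
  rw [hDeq] at hDE₁
  have h3 : -(C * n) = b • V + (y + y) • E₁ := by
    rw [← hDE₁, add_mul, add_mul, add_mul, smul_mul_assoc, smul_mul_assoc, smul_mul_assoc, hUE₁, hVE₁, smul_zero,
      zero_add, sub_mul, hE₁E₁, hE₂E₁, sub_zero, hSE₁, add_smul]
    abel
  have h4 := congrArg (fun F => E₁ * F) h3
  simp only [mul_neg, mul_add, mul_smul_comm, hE₁V, smul_zero, zero_add, hE₁E₁, ← mul_assoc, hE₁C] at h4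
  exact ⟨-(y + y), by rw [neg_smul, ← h4, neg_neg]⟩

/-- **`m e ∈ ℂE₁`** for a lowering `m = E₁m ∈ 𝔊` and a raising `e = eE₁ ∈ 𝔊` (the mirror statement of
`UnitaryFourTwo.lower_mul_raise_scalar`, same proof with `[e, m]`). [cite: MoonenZarhin1999LowDim, §2 (2.5)]
[cite: Ribet1983, Thm. 3] -/
theorem UnitaryFourTwo.lower_mul_raise_scalar' {𝔊 : Submodule ℂ (Module.End ℂ W)}
    (hbr : ∀ Y ∈ 𝔊, ∀ Z ∈ 𝔊, Y * Z - Z * Y ∈ 𝔊) {Θ E₁ E₂ U V : Module.End ℂ W}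
    (hE₁ : E₁ ∈ 𝔊) (hE₂ : E₂ ∈ 𝔊) (hU : U ∈ 𝔊) (hV : V ∈ 𝔊) (hE₁0 : E₁ ≠ 0)
    (hsum : E₁ + E₂ = (2 : ℂ)⁻¹ • (1 - Θ)) (hE₁E₁ : E₁ * E₁ = E₁) (hE₂E₂ : E₂ * E₂ = E₂) (hE₁E₂ : E₁ * E₂ = 0)
    (hE₂E₁ : E₂ * E₁ = 0) (hE₁Θ : E₁ * Θ = Θ * E₁) (hE₂Θ : E₂ * Θ = Θ * E₂) (hUΘ : U * Θ = Θ * U)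
    (hVΘ : V * Θ = Θ * V) (hE₁U : E₁ * U = U) (hUE₂ : U * E₂ = U) (hE₂V : E₂ * V = V) (hVE₁ : V * E₁ = V)
    (hUV : U * V = E₁) (hVU : V * U = E₂)
    (hlineU : ∀ X ∈ 𝔊, X * Θ = Θ * X → ∃ c : ℂ, E₁ * X * E₂ = c • U)
    (hlineV : ∀ X ∈ 𝔊, X * Θ = Θ * X → ∃ c : ℂ, E₂ * X * E₁ = c • V)
    (hgraded : ∀ X ∈ 𝔊, X * Θ = Θ * X →
      E₁ * X * E₂ ∈ 𝔊 ∧ E₂ * X * E₁ ∈ 𝔊 ∧ (X - E₁ * X * E₂ - E₂ * X * E₁) * E₂ = E₂ * (X - E₁ * X * E₂ - E₂ * X * E₁))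
    {e m : Module.End ℂ W} (he : e ∈ 𝔊) (hΘe : Θ * e = e) (heΘ : e * Θ = -e) (heE₁ : e * E₁ = e)
    (hm : m ∈ 𝔊) (hΘm : Θ * m = -m) (hmΘ : m * Θ = m) (hE₁m : E₁ * m = m) :
    ∃ d : ℂ, m * e = d • E₁ := by
  have hmπ : m * (E₁ + E₂) = 0 := by
    rw [hsum, mul_smul_comm, mul_sub, mul_one, hmΘ, sub_self, smul_zero]
  have hmE₁ : m * E₁ = 0 := by
    have h : m * E₁ = m * (E₁ + E₂) * E₁ := by rw [mul_add, add_mul, mul_assoc m E₂ E₁, hE₂E₁, mul_zero, add_zero,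
      mul_assoc, hE₁E₁]
    rw [h, hmπ, zero_mul]
  have hmE₂ : m * E₂ = 0 := by
    have h : m * E₂ = m * (E₁ + E₂) * E₂ := by rw [mul_add, add_mul, mul_assoc m E₁ E₂, hE₁E₂, mul_zero, zero_add,
      mul_assoc, hE₂E₂]
    rw [h, hmπ, zero_mul]
  have heE₂ : e * E₂ = 0 := by rw [← heE₁, mul_assoc, hE₁E₂, mul_zero]
  have hD : e * m - m * e ∈ 𝔊 := hbr e he m hm
  have hDΘ : (e * m - m * e) * Θ = Θ * (e * m - m * e) := by
    rw [sub_mul, mul_sub, mul_assoc, hmΘ, ← mul_assoc, hΘe, mul_assoc, heΘ, mul_neg, ← mul_assoc, hΘm, neg_mul]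
  obtain ⟨a, b, y, S, hS, hDeq, hSΘ, hSE₂, hSU, hSV⟩ := UnitaryFourTwo.levi_decomposition hbr hE₁ hE₂ hU hV hE₁0 hsum
    hE₁E₁ hE₂E₂ hE₁E₂ hE₂E₁ hE₁Θ hE₂Θ hUΘ hVΘ hE₁U hUE₂ hE₂V hVE₁ hUV hVU hlineU hlineV hgraded hD hDΘ
  have hUE₁ : U * E₁ = 0 := by rw [← hUE₂, mul_assoc, hE₂E₁, mul_zero]
  have hVE₂ : V * E₂ = 0 := by rw [← hVE₁, mul_assoc, hE₁E₂, mul_zero]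
  have hE₁V : E₁ * V = 0 := by rw [← hE₂V, ← mul_assoc, hE₁E₂, zero_mul]
  have hSE₁ : S * E₁ = y • E₁ := by
    have hDE₂ : (e * m - m * e) * E₂ = 0 := by rw [sub_mul, mul_assoc, hmE₂, mul_zero, mul_assoc, heE₂, mul_zero, sub_self]
    rw [hDeq] at hDE₂
    have h2 : a • U - y • E₂ + S * E₂ = 0 := by
      have h := hDE₂
      rw [add_mul, add_mul, add_mul, smul_mul_assoc, smul_mul_assoc, smul_mul_assoc, hUE₂, hVE₂, smul_zero, add_zero,
        sub_mul, hE₁E₂, hE₂E₂, zero_sub, smul_neg] at h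
      rw [← h]; abel
    have haU : a • U = 0 := by
      have h := congrArg (fun F => E₁ * F) h2
      simp only [mul_add, mul_sub, mul_smul_comm, hE₁U, hE₁E₂, smul_zero, sub_zero, mul_zero] at h
      have hSE₁c : S * E₁ = E₁ * S := by
        have h' : S * (E₁ + E₂) = (E₁ + E₂) * S := by
          rw [hsum, mul_smul_comm, smul_mul_assoc, mul_sub, sub_mul, mul_one, one_mul, hSΘ]
        rw [mul_add, add_mul, hSE₂] at h'
        exact add_right_cancel h'
      rw [← mul_assoc, ← hSE₁c, mul_assoc, hE₁E₂, mul_zero, add_zero] at h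
      exact h
    have hSE₂' : S * E₂ = y • E₂ := by
      rw [haU, zero_sub, neg_add_eq_zero] at h2
      exact h2.symm
    calc S * E₁ = S * (U * V) := by rw [hUV]
      _ = U * (S * (E₂ * V)) := by rw [← mul_assoc, hSU, mul_assoc, hE₂V]
      _ = y • E₁ := by rw [← mul_assoc S, hSE₂', smul_mul_assoc, hE₂V, mul_smul_comm, hUV]
  have hDE₁ : (e * m - m * e) * E₁ = -(m * e) := by rw [sub_mul, mul_assoc, hmE₁, mul_zero, zero_sub, mul_assoc, heE₁]
  rw [hDeq] at hDE₁
  have h3 : -(m * e) = b • V + (y + y) • E₁ := by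
    rw [← hDE₁, add_mul, add_mul, add_mul, smul_mul_assoc, smul_mul_assoc, smul_mul_assoc, hUE₁, hVE₁, smul_zero,
      zero_add, sub_mul, hE₁E₁, hE₂E₁, sub_zero, hSE₁, add_smul]
    abel
  have h4 := congrArg (fun F => E₁ * F) h3
  simp only [mul_neg, mul_add, mul_smul_comm, hE₁V, smul_zero, zero_add, hE₁E₁, ← mul_assoc, hE₁m] at h4
  exact ⟨-(y + y), by rw [neg_smul, ← h4, neg_neg]⟩

end Scalars

/-! ### §2 The tensor skeleton -/

section Skeleton

variable [FiniteDimensional ℂ W]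

/-- **THE TENSOR SKELETON** (module docstring): matrix units `fᵢgⱼ ∈ 𝔊` for `f = (e, E₁, V)`, `g = (C, E₁, U)` with
`2`-dimensional diagonal blocks, `Θ = eC − E₁ − E₂`, the decomposition `𝔊 = 𝔠 + Σ ℂ fᵢgⱼ` with `𝔠` the centraliser of
`e, C, E₁, U, V`, and fullness of `𝔠` on the block `range E₁`. [cite: MoonenZarhin1999LowDim, §2 (2.5), Thm. (2.7)]
[cite: Ribet1983, Thm. 3] [cite: Tankeev1996, Introduction] [cite: GoodmanWallachGTM255, §4.1.1] -/
theorem UnitaryFourTwo.exists_matrix_units {𝔊 : Submodule ℂ (Module.End ℂ W)}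
    (hbr : ∀ Y ∈ 𝔊, ∀ Z ∈ 𝔊, Y * Z - Z * Y ∈ 𝔊) (h1 : (1 : Module.End ℂ W) ∈ 𝔊)
    (hirr : ∀ U : Submodule ℂ W, (∀ A ∈ 𝔊, ∀ u ∈ U, A u ∈ U) → U = ⊥ ∨ U = ⊤)
    {Θ : Module.End ℂ W} (hΘ : Θ ∈ 𝔊) (hΘΘ : Θ * Θ = 1)
    {P Q : Submodule ℂ W} (hP : ∀ x, x ∈ P ↔ Θ x = x) (hQ : ∀ x, x ∈ Q ↔ Θ x = -x)
    (hP2 : finrank ℂ P = 2) (hQ4 : finrank ℂ Q = 4)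
    (hNred : ∃ U₀ : Submodule ℂ W, U₀ ≤ Q ∧ U₀ ≠ ⊥ ∧ U₀ ≠ Q ∧
      ∀ X ∈ 𝔊, X * Θ = Θ * X → (∀ p ∈ P, X p = 0) → ∀ y ∈ U₀, X y ∈ U₀) :
    ∃ e C E₁ E₂ U V : Module.End ℂ W,
      (e ∈ 𝔊 ∧ C ∈ 𝔊 ∧ E₁ ∈ 𝔊 ∧ E₂ ∈ 𝔊 ∧ U ∈ 𝔊 ∧ V ∈ 𝔊 ∧ e * U ∈ 𝔊 ∧ V * C ∈ 𝔊) ∧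
      (C * e = E₁ ∧ C * E₁ = 0 ∧ C * V = 0 ∧ E₁ * e = 0 ∧ E₁ * E₁ = E₁ ∧ E₁ * V = 0 ∧ U * e = 0 ∧ U * E₁ = 0 ∧
        U * V = E₁) ∧
      (e * E₁ = e ∧ V * E₁ = V ∧ E₁ * C = C ∧ E₁ * U = U ∧ V * U = E₂ ∧ e * C + E₁ + E₂ = 1 ∧
        Θ = e * C - E₁ - E₂ ∧ finrank ℂ (LinearMap.range E₁) = 2) ∧
      (∀ X ∈ 𝔊, ∃ c₁₁ c₁₂ c₁₃ c₂₁ c₂₂ c₂₃ c₃₁ c₃₂ c₃₃ : ℂ, ∃ S ∈ 𝔊,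
        (S * e = e * S ∧ S * C = C * S ∧ S * E₁ = E₁ * S ∧ S * U = U * S ∧ S * V = V * S) ∧
        X = S + c₁₁ • (e * C) + c₁₂ • e + c₁₃ • (e * U) + c₂₁ • C + c₂₂ • E₁ + c₂₃ • U + c₃₁ • (V * C) + c₃₂ • V +
          c₃₃ • (V * U)) ∧
      (∀ y : Module.End ℂ W, ∃ S ∈ 𝔊,
        (S * e = e * S ∧ S * C = C * S ∧ S * E₁ = E₁ * S ∧ S * U = U * S ∧ S * V = V * S) ∧
        E₁ * S * E₁ = E₁ * y * E₁) := by
  classical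
  have hΘΘv : ∀ v, Θ (Θ v) = v := fun v => by rw [← Module.End.mul_apply, hΘΘ, Module.End.one_apply]
  -- A. the Levi data (brick V2a)
  obtain ⟨E₁, E₂, U, V', C, hE₁, hE₂, hU, hV', hC, ⟨hsum, hE₁E₁, hE₂E₂, hE₁E₂, hE₂E₁, hE₂Θ, hr₁, hr₂⟩,
    ⟨hΘC, hCΘ, hCinj, hE₁C'⟩, ⟨hE₁U, hUE₂, hUonto, hUinj⟩, ⟨hE₂V', hV'E₁, hV'onto, hV'inj⟩, hlevi, hgraded⟩ :=
    UnitaryFourTwo.exists_levi_data hbr h1 hirr hΘ hΘΘ hP hQ hP2 hQ4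
  have hE₁C : E₁ * C = C := LinearMap.ext fun w => by rw [Module.End.mul_apply, hE₁C' w]
  -- B. derived facts
  have hπQq : ∀ q ∈ Q, ((2 : ℂ)⁻¹ • ((1 : Module.End ℂ W) - Θ)) q = q := fun q hq => by
    rw [LinearMap.smul_apply, LinearMap.sub_apply, Module.End.one_apply, (hQ q).1 hq, sub_neg_eq_add, ← two_smul ℂ q,
      smul_smul, inv_mul_cancel₀ two_ne_zero, one_smul]
  have hπQp : ∀ p ∈ P, ((2 : ℂ)⁻¹ • ((1 : Module.End ℂ W) - Θ)) p = 0 := fun p hp => by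
    rw [LinearMap.smul_apply, LinearMap.sub_apply, Module.End.one_apply, (hP p).1 hp, sub_self, smul_zero]
  have hπQmem : ∀ w, ((2 : ℂ)⁻¹ • ((1 : Module.End ℂ W) - Θ)) w ∈ Q := fun w =>
    (hQ _).2 (by rw [LinearMap.smul_apply, LinearMap.sub_apply, Module.End.one_apply, map_smul, map_sub, hΘΘv,
      ← smul_neg, neg_sub])
  have hE₁P : ∀ p ∈ P, E₁ p = 0 := fun p hp => by
    have h : E₁ p = E₁ ((E₁ + E₂) p) := by
      rw [LinearMap.add_apply, map_add, ← Module.End.mul_apply, ← Module.End.mul_apply, hE₁E₁, hE₁E₂,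
        LinearMap.zero_apply, add_zero]
    rw [h, hsum, hπQp p hp, map_zero]
  have hE₂P : ∀ p ∈ P, E₂ p = 0 := fun p hp => by
    have h : E₂ p = E₂ ((E₁ + E₂) p) := by
      rw [LinearMap.add_apply, map_add, ← Module.End.mul_apply, ← Module.End.mul_apply, hE₂E₁, hE₂E₂,
        LinearMap.zero_apply, zero_add]
    rw [h, hsum, hπQp p hp, map_zero]
  have hE₁Q : ∀ w, E₁ w ∈ Q := fun w => by
    have h : E₁ w = (E₁ + E₂) (E₁ w) := by
      rw [LinearMap.add_apply, ← Module.End.mul_apply, ← Module.End.mul_apply, hE₁E₁, hE₂E₁, LinearMap.zero_apply,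
        add_zero]
    rw [h, hsum]; exact hπQmem _
  have hE₂Q : ∀ w, E₂ w ∈ Q := fun w => by
    have h : E₂ w = (E₁ + E₂) (E₂ w) := by
      rw [LinearMap.add_apply, ← Module.End.mul_apply, ← Module.End.mul_apply, hE₁E₂, hE₂E₂, LinearMap.zero_apply,
        zero_add]
    rw [h, hsum]; exact hπQmem _
  have hE₁Θ : E₁ * Θ = Θ * E₁ := by
    have h : (E₁ + E₂) * Θ = Θ * (E₁ + E₂) := by
      rw [hsum, mul_smul_comm, smul_mul_assoc, mul_sub, sub_mul, mul_one, one_mul, hΘΘ]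
    rw [add_mul, mul_add, hE₂Θ] at h
    exact add_right_cancel h
  have hcommΘ : ∀ Y : Module.End ℂ W, (∀ p ∈ P, Y p = 0) → (∀ w, Y w ∈ Q) → Y * Θ = Θ * Y := by
    intro Y hYP hYQ
    refine UnitaryFourTwo.end_ext hΘΘ hP hQ (fun p hp => ?_) (fun q hq => ?_)
    · rw [Module.End.mul_apply, Module.End.mul_apply, (hP p).1 hp, hYP p hp, map_zero]
    · rw [Module.End.mul_apply, Module.End.mul_apply, (hQ q).1 hq, map_neg, (hQ _).1 (hYQ q)]
  have hUΘ : U * Θ = Θ * U := hcommΘ U (fun p hp => by rw [← hUE₂, Module.End.mul_apply, hE₂P p hp, map_zero])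
    (fun w => by rw [← hE₁U, Module.End.mul_apply]; exact hE₁Q _)
  have hV'Θ : V' * Θ = Θ * V' := hcommΘ V' (fun p hp => by rw [← hV'E₁, Module.End.mul_apply, hE₁P p hp, map_zero])
    (fun w => by rw [← hE₂V', Module.End.mul_apply]; exact hE₂Q _)
  have hmemR₁ : ∀ x, E₁ x = x ↔ x ∈ LinearMap.range E₁ := fun x =>
    ⟨fun h => ⟨x, h⟩, by rintro ⟨w, rfl⟩; rw [← Module.End.mul_apply, hE₁E₁]⟩
  have hE₁0 : E₁ ≠ 0 := by
    intro h0
    rw [h0, LinearMap.range_zero, finrank_bot] at hr₁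
    exact two_ne_zero hr₁.symm
  -- C. the lines (brick V2b) and the normalised unit pair
  obtain ⟨hlines, lam, hlam0, hUV', hV'U⟩ := UnitaryFourTwo.lines_of_annP_reducible hbr hΘΘ hP hQ hE₁ hE₂ hU hV'
    hsum hE₁E₁ hE₂E₂ hE₁E₂ hE₂E₁ hE₂Θ hr₁ hr₂ hE₁U hUE₂ hUonto hUinj hE₂V' hV'E₁ hV'onto hV'inj hlevi hgraded hNred
  set V : Module.End ℂ W := lam⁻¹ • V' with hVdef
  have hV : V ∈ 𝔊 := Submodule.smul_mem _ _ hV'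
  have hUV : U * V = E₁ := by rw [hVdef, mul_smul_comm, hUV', smul_smul, inv_mul_cancel₀ hlam0, one_smul]
  have hVU : V * U = E₂ := by rw [hVdef, smul_mul_assoc, hV'U, smul_smul, inv_mul_cancel₀ hlam0, one_smul]
  have hE₂V : E₂ * V = V := by rw [hVdef, mul_smul_comm, hE₂V']
  have hVE₁ : V * E₁ = V := by rw [hVdef, smul_mul_assoc, hV'E₁]
  have hVΘ : V * Θ = Θ * V := by rw [hVdef, smul_mul_assoc, mul_smul_comm, hV'Θ]
  have hlineU : ∀ X ∈ 𝔊, X * Θ = Θ * X → ∃ c : ℂ, E₁ * X * E₂ = c • U := fun X hX hXΘ => (hlines X hX hXΘ).1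
  have hlineV : ∀ X ∈ 𝔊, X * Θ = Θ * X → ∃ c : ℂ, E₂ * X * E₁ = c • V := fun X hX hXΘ => by
    obtain ⟨c, hc⟩ := (hlines X hX hXΘ).2
    refine ⟨c * lam, ?_⟩
    rw [hc, hVdef, smul_smul, mul_assoc, mul_inv_cancel₀ hlam0, mul_one]
  clear_value V
  -- more products
  have hUE₁ : U * E₁ = 0 := by rw [← hUE₂, mul_assoc, hE₂E₁, mul_zero]
  have hVE₂ : V * E₂ = 0 := by rw [← hVE₁, mul_assoc, hE₁E₂, mul_zero]
  have hE₁V : E₁ * V = 0 := by rw [← hE₂V, ← mul_assoc, hE₁E₂, zero_mul]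
  have hE₂U : E₂ * U = 0 := by rw [← hE₁U, ← mul_assoc, hE₂E₁, zero_mul]
  have hUP : ∀ p ∈ P, U p = 0 := fun p hp => by rw [← hUE₂, Module.End.mul_apply, hE₂P p hp, map_zero]
  have hVP : ∀ p ∈ P, V p = 0 := fun p hp => by rw [← hVE₁, Module.End.mul_apply, hE₁P p hp, map_zero]
  have hVQ : ∀ w, V w ∈ Q := fun w => by rw [← hE₂V, Module.End.mul_apply]; exact hE₂Q _
  have hCπ : C * (E₁ + E₂) = 0 := by rw [hsum, mul_smul_comm, mul_sub, mul_one, hCΘ, sub_self, smul_zero]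
  have hCE₁ : C * E₁ = 0 := by
    have h : C * E₁ = C * (E₁ + E₂) * E₁ := by
      rw [mul_add, add_mul, mul_assoc C E₂ E₁, hE₂E₁, mul_zero, add_zero, mul_assoc, hE₁E₁]
    rw [h, hCπ, zero_mul]
  have hCE₂ : C * E₂ = 0 := by
    have h : C * E₂ = C * (E₁ + E₂) * E₂ := by
      rw [mul_add, add_mul, mul_assoc C E₁ E₂, hE₁E₂, mul_zero, zero_add, mul_assoc, hE₂E₂]
    rw [h, hCπ, zero_mul]
  have hCC : C * C = 0 := UnitaryThetaCore.mul_self_eq_zero_of_lower hΘC hCΘ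
  have hCU : C * U = 0 := by rw [← hE₁U, ← mul_assoc, hCE₁, zero_mul]
  have hCV : C * V = 0 := by rw [← hE₂V, ← mul_assoc, hCE₂, zero_mul]
  -- E. wrappers for bricks V2c and §1
  have hLevi : ∀ X ∈ 𝔊, X * Θ = Θ * X → ∃ a b y : ℂ, ∃ S : Module.End ℂ W, S ∈ 𝔊 ∧
      X = a • U + b • V + y • (E₁ - E₂) + S ∧ S * Θ = Θ * S ∧ S * E₂ = E₂ * S ∧ S * U = U * S ∧ S * V = V * S :=
    fun X hX hXΘ => UnitaryFourTwo.levi_decomposition hbr hE₁ hE₂ hU hV hE₁0 hsum hE₁E₁ hE₂E₂ hE₁E₂ hE₂E₁ hE₁Θ hE₂Θ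
      hUΘ hVΘ hE₁U hUE₂ hE₂V hVE₁ hUV hVU hlineU hlineV hgraded hX hXΘ
  have hScal : ∀ n ∈ 𝔊, Θ * n = n → n * Θ = -n → n * E₁ = n → ∃ c : ℂ, C * n = c • E₁ :=
    fun n hn h1' h2' h3' => UnitaryFourTwo.lower_mul_raise_scalar hbr hE₁ hE₂ hU hV hE₁0 hsum hE₁E₁ hE₂E₂ hE₁E₂ hE₂E₁
      hE₁Θ hE₂Θ hUΘ hVΘ hE₁U hUE₂ hE₂V hVE₁ hUV hVU hlineU hlineV hgraded hC hΘC hCΘ hE₁C hn h1' h2' h3'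
  -- raising operators with `nE₁ = n`: `Cn = cE₁`, and `Cn = 0 ⟹ n = 0`
  have hraiseP : ∀ n : Module.End ℂ W, Θ * n = n → ∀ w, n w ∈ P := fun n hn w =>
    (hP _).2 (by rw [← Module.End.mul_apply, hn])
  have hNzero : ∀ n : Module.End ℂ W, Θ * n = n → C * n = 0 → n = 0 := fun n hn hCn =>
    LinearMap.ext fun w => hCinj _ (hraiseP n hn w) (by rw [← Module.End.mul_apply, hCn, LinearMap.zero_apply])
  have hNdep : ∀ n n' : Module.End ℂ W, Θ * n = n → Θ * n' = n' → ∀ c c' : ℂ, C * n = c • E₁ → C * n' = c' • E₁ →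
      c' • n = c • n' := by
    intro n n' hn hn' c c' hcn hcn'
    have h : c' • n - c • n' = 0 := hNzero _ (by rw [mul_sub, mul_smul_comm, mul_smul_comm, hn, hn'])
      (by rw [mul_sub, mul_smul_comm, mul_smul_comm, hcn, hcn', smul_smul, smul_smul, mul_comm, sub_self])
    exact sub_eq_zero.1 h
  -- G. a raising `n₀` with `n₀E₁ = n₀` and `Cn₀ = c₀E₁`, `c₀ ≠ 0`
  have hP0 : ∃ p : W, p ≠ 0 ∧ Θ p = p := by
    have hpos : 0 < finrank ℂ P := by rw [hP2]; exact two_pos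
    obtain ⟨⟨p, hp⟩, hp0⟩ := Module.finrank_pos_iff_exists_ne_zero.1 hpos
    exact ⟨p, fun h => hp0 (Subtype.ext h), (hP p).1 hp⟩
  have hQ0 : ∃ q : W, q ≠ 0 ∧ Θ q = -q := by
    have hpos : 0 < finrank ℂ Q := by rw [hQ4]; norm_num
    obtain ⟨⟨q, hq⟩, hq0⟩ := Module.finrank_pos_iff_exists_ne_zero.1 hpos
    exact ⟨q, fun h => hq0 (Subtype.ext h), (hQ q).1 hq⟩
  obtain ⟨B, hB, hΘB, hBΘ, hB0⟩ : ∃ B ∈ 𝔊, Θ * B = B ∧ B * Θ = -B ∧ B ≠ 0 := by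
    by_contra hno
    push Not at hno
    obtain ⟨p, hp0, hp⟩ := hP0
    have hspan := UnitaryThetaCore.mem_span_raise_apply hbr hirr hΘ hΘΘ hQ0 hp
    have hbot : Submodule.span ℂ {x : W | ∃ B ∈ 𝔊, Θ * B = B ∧ B * Θ = -B ∧ ∃ w, B w = x} = ⊥ := by
      rw [Submodule.span_eq_bot]
      rintro x ⟨B, hB, hΘB, hBΘ, w, rfl⟩
      rw [hno B hB hΘB hBΘ, LinearMap.zero_apply]
    rw [hbot, Submodule.mem_bot] at hspan
    exact hp0 hspan
  have hBπ : B * (E₁ + E₂) = B := by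
    rw [hsum, mul_smul_comm, mul_sub, mul_one, hBΘ, sub_neg_eq_add, ← two_smul ℂ B, smul_smul,
      inv_mul_cancel₀ two_ne_zero, one_smul]
  obtain ⟨hn₁, hΘn₁, hn₁Θ⟩ := UnitaryThetaCore.raise_mul_mem hbr hΘΘ hP hE₁ hE₁P hB hΘB
  obtain ⟨hn₂, hΘn₂, hn₂Θ⟩ := UnitaryThetaCore.raise_mul_mem hbr hΘΘ hP hV hVP hB hΘB
  have hn₁E₁ : B * E₁ * E₁ = B * E₁ := by rw [mul_assoc, hE₁E₁]
  have hn₂E₁ : B * V * E₁ = B * V := by rw [mul_assoc, hVE₁]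
  obtain ⟨c₁, hc₁⟩ := hScal _ hn₁ hΘn₁ hn₁Θ hn₁E₁
  obtain ⟨c₂, hc₂⟩ := hScal _ hn₂ hΘn₂ hn₂Θ hn₂E₁
  obtain ⟨n₀, hn₀, hΘn₀, hn₀Θ, hn₀E₁, c₀, hc₀0, hCn₀⟩ : ∃ n₀ ∈ 𝔊, Θ * n₀ = n₀ ∧ n₀ * Θ = -n₀ ∧ n₀ * E₁ = n₀ ∧
      ∃ c₀ : ℂ, c₀ ≠ 0 ∧ C * n₀ = c₀ • E₁ := by
    by_cases h₁ : c₁ = 0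
    · by_cases h₂ : c₂ = 0
      · exfalso
        apply hB0
        have hz₁ : B * E₁ = 0 := hNzero _ hΘn₁ (by rw [hc₁, h₁, zero_smul])
        have hz₂ : B * V = 0 := hNzero _ hΘn₂ (by rw [hc₂, h₂, zero_smul])
        rw [← hBπ, mul_add, hz₁, zero_add, ← hVU, ← mul_assoc, hz₂, zero_mul]
      · exact ⟨B * V, hn₂, hΘn₂, hn₂Θ, hn₂E₁, c₂, h₂, hc₂⟩
    · exact ⟨B * E₁, hn₁, hΘn₁, hn₁Θ, hn₁E₁, c₁, h₁, hc₁⟩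
  -- H. the matrix unit `e` (block `(1,2)`): `Ce = E₁`, `eC = 1 − E₁ − E₂`
  set e : Module.End ℂ W := c₀⁻¹ • n₀ with hedef
  have he : e ∈ 𝔊 := Submodule.smul_mem _ _ hn₀
  have hΘe : Θ * e = e := by rw [hedef, mul_smul_comm, hΘn₀]
  have heΘ : e * Θ = -e := by rw [hedef, smul_mul_assoc, hn₀Θ, smul_neg]
  have heE₁ : e * E₁ = e := by rw [hedef, smul_mul_assoc, hn₀E₁]
  have hCe : C * e = E₁ := by rw [hedef, mul_smul_comm, hCn₀, smul_smul, inv_mul_cancel₀ hc₀0, one_smul]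
  clear_value e
  have heP : ∀ p ∈ P, e p = 0 := UnitaryFourTwo.apply_eq_zero_of_mul_theta heΘ hP
  have hemem : ∀ w, e w ∈ P := hraiseP e hΘe
  have heE₂ : e * E₂ = 0 := by rw [← heE₁, mul_assoc, hE₁E₂, mul_zero]
  have hπe : (E₁ + E₂) * e = 0 := by rw [hsum, smul_mul_assoc, sub_mul, one_mul, hΘe, sub_self, smul_zero]
  have hE₁e : E₁ * e = 0 := by
    have h : E₁ * e = E₁ * ((E₁ + E₂) * e) := by
      rw [← mul_assoc, mul_add, hE₁E₁, hE₁E₂, add_zero]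
    rw [h, hπe, mul_zero]
  have hE₂e : E₂ * e = 0 := by
    have h : E₂ * e = E₂ * ((E₁ + E₂) * e) := by
      rw [← mul_assoc, mul_add, hE₂E₁, hE₂E₂, zero_add]
    rw [h, hπe, mul_zero]
  have hUe : U * e = 0 := by rw [← hUE₂, mul_assoc, hE₂e, mul_zero]
  have hVe : V * e = 0 := by rw [← hVE₁, mul_assoc, hE₁e, mul_zero]
  have hee : e * e = 0 := by
    calc e * e = e * E₁ * e := by rw [heE₁]
      _ = 0 := by rw [mul_assoc, hE₁e, mul_zero]
  -- `e` maps `range E₁` onto `P`, whence `eC = π_P`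
  have heonto : ∀ p ∈ P, ∃ x, E₁ x = x ∧ e x = p := by
    let φ : LinearMap.range E₁ →ₗ[ℂ] P := LinearMap.codRestrict P (e ∘ₗ (LinearMap.range E₁).subtype) fun x => hemem x
    have hφinj : Function.Injective φ := by
      refine (injective_iff_map_eq_zero φ).2 fun x hx => ?_
      have h : e (x : W) = 0 := congrArg Subtype.val hx
      apply Subtype.ext
      change (x : W) = 0
      have hx1 : E₁ (x : W) = x := (hmemR₁ _).2 x.2
      have h2 : C (e (x : W)) = E₁ x := by rw [← Module.End.mul_apply, hCe]
      rw [← hx1, ← h2, h, map_zero]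
    have hφsurj : Function.Surjective φ :=
      (LinearMap.injective_iff_surjective_of_finrank_eq_finrank (by rw [hr₁, hP2])).1 hφinj
    intro p hp
    obtain ⟨x, hx⟩ := hφsurj ⟨p, hp⟩
    exact ⟨x, (hmemR₁ _).2 x.2, congrArg Subtype.val hx⟩
  have heC : e * C = 1 - (E₁ + E₂) := by
    refine UnitaryFourTwo.end_ext hΘΘ hP hQ (fun p hp => ?_) (fun q hq => ?_)
    · obtain ⟨x, hx, hxp⟩ := heonto p hp
      rw [Module.End.mul_apply, LinearMap.sub_apply, Module.End.one_apply, hsum, hπQp p hp, sub_zero, ← hxp,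
        ← Module.End.mul_apply C e, hCe, hx]
    · have hCq : C q = 0 := by
        have h : C q = -(C q) := by
          conv_lhs => rw [← neg_neg q, ← (hQ q).1 hq, map_neg, ← Module.End.mul_apply, hCΘ]
        have h2 : (2 : ℂ) • C q = 0 := by rw [two_smul]; nth_rewrite 2 [h]; rw [add_neg_cancel]
        exact (smul_eq_zero.1 h2).resolve_left two_ne_zero
      rw [Module.End.mul_apply, hCq, map_zero, LinearMap.sub_apply, Module.End.one_apply, hsum, hπQq q hq, sub_self]
  have hΘeq : Θ = e * C - E₁ - E₂ := by
    have h : e * C - E₁ - E₂ = 1 - (E₁ + E₂) - (E₁ + E₂) := by rw [heC]; abel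
    rw [h, hsum]
    refine LinearMap.ext fun w => ?_
    simp only [LinearMap.sub_apply, LinearMap.smul_apply, Module.End.one_apply]
    module
  have heCE₁ : e * C * E₁ = 0 := by rw [mul_assoc, hCE₁, mul_zero]
  have hE₁eC : E₁ * (e * C) = 0 := by rw [← mul_assoc, hE₁e, zero_mul]
  -- membership of the remaining units
  obtain ⟨heU, -, -⟩ := UnitaryThetaCore.raise_mul_mem hbr hΘΘ hP hU hUP he hΘe
  obtain ⟨hVC, -, -⟩ := UnitaryThetaCore.mul_lower_mem hbr hQ hV hVQ hC hCΘ
  -- lowering operators with `E₁m = m` are multiples of `C`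
  have hlowC : ∀ m ∈ 𝔊, Θ * m = -m → m * Θ = m → E₁ * m = m → ∃ d : ℂ, m = d • C := by
    intro m hm hΘm hmΘ hE₁m
    obtain ⟨d, hd⟩ := UnitaryFourTwo.lower_mul_raise_scalar' hbr hE₁ hE₂ hU hV hE₁0 hsum hE₁E₁ hE₂E₂ hE₁E₂ hE₂E₁
      hE₁Θ hE₂Θ hUΘ hVΘ hE₁U hUE₂ hE₂V hVE₁ hUV hVU hlineU hlineV hgraded he hΘe heΘ heE₁ hm hΘm hmΘ hE₁m
    refine ⟨d, ?_⟩
    have hmπ : m * (E₁ + E₂) = 0 := by rw [hsum, mul_smul_comm, mul_sub, mul_one, hmΘ, sub_self, smul_zero]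
    calc m = m * (e * C + (E₁ + E₂)) := by rw [heC, sub_add_cancel, mul_one]
      _ = d • C := by rw [mul_add, hmπ, add_zero, ← mul_assoc, hd, smul_mul_assoc, hE₁C]
  -- raising operators with `nE₁ = n` are multiples of `e`
  have hraisee : ∀ n ∈ 𝔊, Θ * n = n → n * Θ = -n → n * E₁ = n → ∃ c : ℂ, n = c • e := by
    intro n hn hΘn hnΘ hnE₁
    obtain ⟨c, hc⟩ := hScal n hn hΘn hnΘ hnE₁
    refine ⟨c, ?_⟩
    have h := hNdep n e hΘn hΘe c 1 hc (by rw [hCe, one_smul])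
    rwa [one_smul] at h
  -- centraliser adjustment: from `S` commuting with `Θ, U, V` to `S − a·eC` commuting with `e, C, E₁, U, V`
  have hcentral : ∀ S ∈ 𝔊, S * Θ = Θ * S → S * U = U * S → S * V = V * S →
      ∃ a : ℂ, (S - a • (e * C)) ∈ 𝔊 ∧ (S - a • (e * C)) * e = e * (S - a • (e * C)) ∧
        (S - a • (e * C)) * C = C * (S - a • (e * C)) ∧ (S - a • (e * C)) * E₁ = E₁ * (S - a • (e * C)) ∧
        (S - a • (e * C)) * U = U * (S - a • (e * C)) ∧ (S - a • (e * C)) * V = V * (S - a • (e * C)) ∧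
        E₁ * (S - a • (e * C)) * E₁ = E₁ * S * E₁ := by
    intro S hS hSΘ hSU hSV
    have hSE₁ : S * E₁ = E₁ * S := by rw [← hUV, ← mul_assoc, hSU, mul_assoc, hSV, mul_assoc]
    have hSE₂ : S * E₂ = E₂ * S := by rw [← hVU, ← mul_assoc, hSV, mul_assoc, hSU, mul_assoc]
    -- `[S, e] = a e`
    have hSe𝔊 : S * e - e * S ∈ 𝔊 := hbr S hS e he
    have hΘSe : Θ * (S * e - e * S) = S * e - e * S := by
      rw [mul_sub, ← mul_assoc, ← hSΘ, mul_assoc, hΘe, ← mul_assoc, hΘe]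
    have hSeΘ : (S * e - e * S) * Θ = -(S * e - e * S) := by
      rw [sub_mul, mul_assoc, heΘ, mul_neg, mul_assoc, hSΘ, ← mul_assoc, heΘ, neg_mul, neg_sub_neg, neg_sub]
    have hSeE₁ : (S * e - e * S) * E₁ = S * e - e * S := by
      rw [sub_mul, mul_assoc, heE₁, mul_assoc, hSE₁, ← mul_assoc, heE₁]
    obtain ⟨a, ha⟩ := hraisee _ hSe𝔊 hΘSe hSeΘ hSeE₁
    -- `[S, C] = d C` with `d = −a` (Jacobi against `[e, C] = eC − E₁`)
    obtain ⟨hSC𝔊', hΘSC, hSCΘ⟩ : (S * C - C * S) ∈ 𝔊 ∧ Θ * (S * C - C * S) = -(S * C - C * S) ∧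
        (S * C - C * S) * Θ = S * C - C * S := by
      refine ⟨hbr S hS C hC, ?_, ?_⟩
      · rw [mul_sub, ← mul_assoc, ← hSΘ, mul_assoc, hΘC, mul_neg, ← mul_assoc, hΘC, neg_mul, neg_sub_neg, neg_sub]
      · rw [sub_mul, mul_assoc, hCΘ, mul_assoc, hSΘ, ← mul_assoc, hCΘ]
    have hE₁SC : E₁ * (S * C - C * S) = S * C - C * S := by
      rw [mul_sub, ← mul_assoc, ← hSE₁, mul_assoc, hE₁C, ← mul_assoc, hE₁C]
    obtain ⟨d, hd⟩ := hlowC _ hSC𝔊' hΘSC hSCΘ hE₁SC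
    have hJac : S * (e * C - C * e) - (e * C - C * e) * S =
        (S * e - e * S) * C + e * (S * C - C * S) - ((S * C - C * S) * e + C * (S * e - e * S)) := by
      simp only [mul_sub, sub_mul, mul_assoc]; abel
    have hzero : S * (e * C - C * e) - (e * C - C * e) * S = 0 := by
      rw [hCe, heC, mul_sub, sub_mul, mul_sub, sub_mul, mul_one, one_mul, mul_add, add_mul, hSE₁, hSE₂, sub_self]
    rw [hzero, ha, hd, smul_mul_assoc, mul_smul_comm, smul_mul_assoc, mul_smul_comm, hCe] at hJac
    -- hJac : 0 = a • (e * C) + d • (e * C) - (d • E₁ + a • E₁); multiply by `e` on the right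
    have he0 : e ≠ 0 := fun h0 => hE₁0 (by rw [← hCe, h0, mul_zero])
    have had : a + d = 0 := by
      have h := congrArg (fun F => F * e) hJac
      simp only [zero_mul, sub_mul, add_mul, smul_mul_assoc, mul_assoc, hCe, heE₁, hE₁e, smul_zero, add_zero,
        sub_zero] at h
      have h' : (a + d) • e = 0 := by rw [add_smul, ← h]
      exact (smul_eq_zero.1 h').resolve_right he0
    have heC𝔊 : e * C ∈ 𝔊 := by rw [heC]; exact Submodule.sub_mem _ h1 (Submodule.add_mem _ hE₁ hE₂)
    have heCe : e * C * e = e := by rw [mul_assoc, hCe, heE₁]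
    have heeC : e * (e * C) = 0 := by rw [← mul_assoc, hee, zero_mul]
    have heCC : e * C * C = 0 := by rw [mul_assoc, hCC, mul_zero]
    have hCeC : C * (e * C) = C := by rw [← mul_assoc, hCe, hE₁C]
    have heCU : e * C * U = 0 := by rw [mul_assoc, hCU, mul_zero]
    have hUeC : U * (e * C) = 0 := by rw [← mul_assoc, hUe, zero_mul]
    have heCV : e * C * V = 0 := by rw [mul_assoc, hCV, mul_zero]
    have hVeC : V * (e * C) = 0 := by rw [← mul_assoc, hVe, zero_mul]
    refine ⟨a, Submodule.sub_mem _ hS (Submodule.smul_mem _ _ heC𝔊), ?_, ?_, ?_, ?_, ?_, ?_⟩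
    · have h : (S - a • (e * C)) * e - e * (S - a • (e * C)) = 0 := by
        rw [sub_mul, mul_sub, smul_mul_assoc, mul_smul_comm, heCe, heeC, smul_zero, sub_zero]
        calc S * e - a • e - e * S = (S * e - e * S) - a • e := by abel
          _ = 0 := by rw [ha, sub_self]
      exact sub_eq_zero.1 h
    · have h : (S - a • (e * C)) * C - C * (S - a • (e * C)) = 0 := by
        rw [sub_mul, mul_sub, smul_mul_assoc, mul_smul_comm, heCC, hCeC, smul_zero, sub_zero]
        calc S * C - (C * S - a • C) = (S * C - C * S) + a • C := by abel
          _ = 0 := by rw [hd, ← add_smul, add_comm, had, zero_smul]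
      exact sub_eq_zero.1 h
    · rw [sub_mul, mul_sub, smul_mul_assoc, mul_smul_comm, heCE₁, hE₁eC, hSE₁]
    · rw [sub_mul, mul_sub, smul_mul_assoc, mul_smul_comm, heCU, hUeC, hSU]
    · rw [sub_mul, mul_sub, smul_mul_assoc, mul_smul_comm, heCV, hVeC, hSV]
    · rw [mul_sub, mul_smul_comm, hE₁eC, smul_zero, sub_zero]
  -- J. decomposition of an arbitrary `X ∈ 𝔊`
  have hdecomp : ∀ X ∈ 𝔊, ∃ c₁₁ c₁₂ c₁₃ c₂₁ c₂₂ c₂₃ c₃₁ c₃₂ c₃₃ : ℂ, ∃ S ∈ 𝔊,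
      (S * e = e * S ∧ S * C = C * S ∧ S * E₁ = E₁ * S ∧ S * U = U * S ∧ S * V = V * S) ∧
      X = S + c₁₁ • (e * C) + c₁₂ • e + c₁₃ • (e * U) + c₂₁ • C + c₂₂ • E₁ + c₂₃ • U + c₃₁ • (V * C) + c₃₂ • V +
        c₃₃ • (V * U) := by
    intro X hX
    obtain ⟨hXp, hΘXp, hXpΘ⟩ := UnitaryThetaCore.raise_relations hbr hΘ hΘΘ hX
    obtain ⟨hXm, hΘXm, hXmΘ⟩ := UnitaryThetaCore.lower_relations hbr hΘ hΘΘ hX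
    have hX₀ := UnitaryThetaCore.zero_mem hbr hΘ hΘΘ hX
    obtain ⟨hXdec, hX₀Θ⟩ := UnitaryThetaCore.decomp hΘΘ X
    set Xp : Module.End ℂ W := (4 : ℂ)⁻¹ • (X + Θ * X - X * Θ - Θ * X * Θ) with hXpdef
    set Xm : Module.End ℂ W := (4 : ℂ)⁻¹ • (X - Θ * X + X * Θ - Θ * X * Θ) with hXmdef
    set X₀ : Module.End ℂ W := (2 : ℂ)⁻¹ • (X + Θ * X * Θ) with hX₀def
    clear_value Xp Xm X₀
    -- the raising part: `Xp = c₁₂ e + c₁₃ eU`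
    have hXpπ : Xp * (E₁ + E₂) = Xp := by
      rw [hsum, mul_smul_comm, mul_sub, mul_one, hXpΘ, sub_neg_eq_add, ← two_smul ℂ Xp, smul_smul,
        inv_mul_cancel₀ two_ne_zero, one_smul]
    obtain ⟨hn₁', hΘn₁', hn₁Θ'⟩ := UnitaryThetaCore.raise_mul_mem hbr hΘΘ hP hE₁ hE₁P hXp hΘXp
    obtain ⟨hn₂', hΘn₂', hn₂Θ'⟩ := UnitaryThetaCore.raise_mul_mem hbr hΘΘ hP hV hVP hXp hΘXp
    obtain ⟨c₁₂, hc₁₂⟩ := hraisee _ hn₁' hΘn₁' hn₁Θ' (by rw [mul_assoc, hE₁E₁])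
    obtain ⟨c₁₃, hc₁₃⟩ := hraisee _ hn₂' hΘn₂' hn₂Θ' (by rw [mul_assoc, hVE₁])
    have hXpeq : Xp = c₁₂ • e + c₁₃ • (e * U) := by
      rw [← hXpπ, mul_add, hc₁₂, ← hVU, ← mul_assoc, hc₁₃, smul_mul_assoc]
    -- the lowering part: `Xm = c₂₁ C + c₃₁ VC`
    have hπXm : (E₁ + E₂) * Xm = Xm := by
      rw [hsum, smul_mul_assoc, sub_mul, one_mul, hΘXm, sub_neg_eq_add, ← two_smul ℂ Xm, smul_smul,
        inv_mul_cancel₀ two_ne_zero, one_smul]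
    obtain ⟨hm₁', hΘm₁', hm₁Θ'⟩ := UnitaryThetaCore.mul_lower_mem hbr hQ hE₁ hE₁Q hXm hXmΘ
    obtain ⟨hm₂', hΘm₂', hm₂Θ'⟩ := UnitaryThetaCore.mul_lower_mem hbr hQ hU (fun w => by
      rw [← hE₁U, Module.End.mul_apply]; exact hE₁Q _) hXm hXmΘ
    obtain ⟨c₂₁, hc₂₁⟩ := hlowC _ hm₁' hΘm₁' hm₁Θ' (by rw [← mul_assoc, hE₁E₁])
    obtain ⟨c₃₁, hc₃₁⟩ := hlowC _ hm₂' hΘm₂' hm₂Θ' (by rw [← mul_assoc, hE₁U])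
    have hXmeq : Xm = c₂₁ • C + c₃₁ • (V * C) := by
      rw [← hπXm, add_mul, hc₂₁, ← hVU, mul_assoc, hc₃₁, mul_smul_comm]
    -- the Levi part
    have hX₀Θ' : X₀ * Θ = Θ * X₀ := hX₀Θ.symm
    obtain ⟨a, b, y, S, hS, hX₀eq, hSΘ, hSE₂, hSU, hSV⟩ := hLevi X₀ hX₀ hX₀Θ'
    obtain ⟨a', hS', hS'e, hS'C, hS'E₁, hS'U, hS'V, -⟩ := hcentral S hS hSΘ hSU hSV
    refine ⟨a', c₁₂, c₁₃, c₂₁, y, a, c₃₁, b, -y, S - a' • (e * C), hS', ⟨hS'e, hS'C, hS'E₁, hS'U, hS'V⟩, ?_⟩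
    rw [hXdec, hXpeq, hXmeq, hX₀eq, ← hVU, smul_sub, neg_smul]
    abel
  -- K. fullness of the centraliser on the block `range E₁`
  have hfull : ∀ y : Module.End ℂ W, ∃ S ∈ 𝔊,
      (S * e = e * S ∧ S * C = C * S ∧ S * E₁ = E₁ * S ∧ S * U = U * S ∧ S * V = V * S) ∧
      E₁ * S * E₁ = E₁ * y * E₁ := by
    intro y
    -- the centraliser `𝔰` of `Θ, U, V` in `𝔊`
    let 𝔰 : Submodule ℂ (Module.End ℂ W) :=
      { carrier := {S | S ∈ 𝔊 ∧ S * Θ = Θ * S ∧ S * U = U * S ∧ S * V = V * S}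
        zero_mem' := ⟨Submodule.zero_mem _, by rw [zero_mul, mul_zero], by rw [zero_mul, mul_zero],
          by rw [zero_mul, mul_zero]⟩
        add_mem' := fun {a b} ha hb => ⟨Submodule.add_mem _ ha.1 hb.1, by rw [add_mul, mul_add, ha.2.1, hb.2.1],
          by rw [add_mul, mul_add, ha.2.2.1, hb.2.2.1], by rw [add_mul, mul_add, ha.2.2.2, hb.2.2.2]⟩
        smul_mem' := fun c {a} ha => ⟨Submodule.smul_mem _ c ha.1, by rw [smul_mul_assoc, mul_smul_comm, ha.2.1],
          by rw [smul_mul_assoc, mul_smul_comm, ha.2.2.1], by rw [smul_mul_assoc, mul_smul_comm, ha.2.2.2]⟩ }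
    have hmem𝔰 : ∀ S, S ∈ 𝔰 ↔ S ∈ 𝔊 ∧ S * Θ = Θ * S ∧ S * U = U * S ∧ S * V = V * S := fun S => Iff.rfl
    have hcomm_br : ∀ (A B Y : Module.End ℂ W), A * Y = Y * A → B * Y = Y * B → (A * B - B * A) * Y = Y * (A * B - B * A) :=
      fun A B Y hA hB => by
        rw [sub_mul, mul_sub, mul_assoc, hB, ← mul_assoc, hA, mul_assoc, mul_assoc, hA, ← mul_assoc B, hB, mul_assoc]
    have hbr𝔰 : ∀ A ∈ 𝔰, ∀ B ∈ 𝔰, A * B - B * A ∈ 𝔰 := fun A hA B hB =>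
      ⟨hbr A hA.1 B hB.1, hcomm_br A B Θ hA.2.1 hB.2.1, hcomm_br A B U hA.2.2.1 hB.2.2.1,
        hcomm_br A B V hA.2.2.2 hB.2.2.2⟩
    have h𝔰R : ∀ S ∈ 𝔰, ∀ x ∈ LinearMap.range E₁, S x ∈ LinearMap.range E₁ := fun S hS x hx => by
      have hSE₁ : S * E₁ = E₁ * S := by
        rw [← hUV, ← mul_assoc, hS.2.2.1, mul_assoc, hS.2.2.2, mul_assoc]
      rw [← hmemR₁] at hx ⊢
      rw [← Module.End.mul_apply, ← hSE₁, Module.End.mul_apply, hx]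
    have hirr𝔰 : ∀ U' ≤ LinearMap.range E₁, (∀ S ∈ 𝔰, ∀ x ∈ U', S x ∈ U') → U' = ⊥ ∨ U' = LinearMap.range E₁ :=
      fun U' hU' hst => UnitaryFourTwo.centraliser_irreducible hbr hΘΘ hQ hE₁ hE₂ hU hV hE₁0 hsum hE₁E₁ hE₂E₂ hE₁E₂
        hE₂E₁ hE₁Θ hE₂Θ hUΘ hVΘ hE₁U hUE₂ hE₂V hVE₁ hUV hVU hlineU hlineV hgraded hlevi U' hU'
        (fun S hS hSΘ hSU hSV x hx => hst S ⟨hS, hSΘ, hSU, hSV⟩ x hx)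
    -- the traceless part of the block of `y`
    have hyR : ∀ x ∈ LinearMap.range E₁, (E₁ * y * E₁) x ∈ LinearMap.range E₁ := fun x _ => ⟨(y * E₁) x, by
      rw [Module.End.mul_apply, Module.End.mul_apply, Module.End.mul_apply]⟩
    set Y₀ : Module.End ℂ (LinearMap.range E₁) := (E₁ * y * E₁).restrict hyR with hY₀def
    set t : ℂ := LinearMap.trace ℂ (LinearMap.range E₁) Y₀ with htdef
    have htr : LinearMap.trace ℂ (LinearMap.range E₁) (Y₀ - ((2 : ℂ)⁻¹ * t) • 1) = 0 := by
      rw [map_sub, map_smul, LinearMap.trace_one, hr₁, ← htdef, smul_eq_mul]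
      push_cast
      ring
    obtain ⟨S₀, hS₀, hS₀Y⟩ := Literature.Algebra.Lie.exists_mem_forall_eq_of_trace_eq_zero (LinearMap.range E₁) hr₁ 𝔰
      hbr𝔰 h𝔰R hirr𝔰 htr
    obtain ⟨hS₀𝔊, hS₀Θ, hS₀U, hS₀V⟩ := (hmem𝔰 S₀).1 hS₀
    -- add back the scalar and adjust to the centraliser of `e, C`
    set S₁ : Module.End ℂ W := S₀ + ((2 : ℂ)⁻¹ * t) • 1 with hS₁def
    have hS₁ : S₁ ∈ 𝔊 := Submodule.add_mem _ hS₀𝔊 (Submodule.smul_mem _ _ h1)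
    have hS₁Θ : S₁ * Θ = Θ * S₁ := by rw [hS₁def, add_mul, mul_add, smul_mul_assoc, mul_smul_comm, one_mul, mul_one, hS₀Θ]
    have hS₁U : S₁ * U = U * S₁ := by rw [hS₁def, add_mul, mul_add, smul_mul_assoc, mul_smul_comm, one_mul, mul_one, hS₀U]
    have hS₁V : S₁ * V = V * S₁ := by rw [hS₁def, add_mul, mul_add, smul_mul_assoc, mul_smul_comm, one_mul, mul_one, hS₀V]
    have hS₁x : ∀ x ∈ LinearMap.range E₁, S₁ x = (E₁ * y * E₁) x := fun x hx => by
      have h := hS₀Y ⟨x, hx⟩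
      -- h : ↑((Y₀ - c • 1) ⟨x,hx⟩) = S₀ x
      rw [LinearMap.sub_apply, LinearMap.smul_apply, Module.End.one_apply, Submodule.coe_sub, Submodule.coe_smul,
        hY₀def, LinearMap.restrict_apply] at h
      rw [hS₁def, LinearMap.add_apply, LinearMap.smul_apply, Module.End.one_apply, ← h]
      simp
    obtain ⟨a', hS', hS'e, hS'C, hS'E₁, hS'U, hS'V, hblock⟩ := hcentral S₁ hS₁ hS₁Θ hS₁U hS₁V
    refine ⟨S₁ - a' • (e * C), hS', ⟨hS'e, hS'C, hS'E₁, hS'U, hS'V⟩, ?_⟩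
    rw [hblock]
    refine LinearMap.ext fun w => ?_
    rw [Module.End.mul_apply, Module.End.mul_apply, hS₁x _ ⟨w, rfl⟩, Module.End.mul_apply, Module.End.mul_apply,
      Module.End.mul_apply, Module.End.mul_apply, ← Module.End.mul_apply E₁ E₁, hE₁E₁, ← Module.End.mul_apply E₁ E₁,
      hE₁E₁]
  exact ⟨e, C, E₁, E₂, U, V, ⟨he, hC, hE₁, hE₂, hU, hV, heU, hVC⟩,
    ⟨hCe, hCE₁, hCV, hE₁e, hE₁E₁, hE₁V, hUe, hUE₁, hUV⟩,
    ⟨heE₁, hVE₁, hE₁C, hE₁U, hVU, by rw [heC]; abel, hΘeq, hr₁⟩, hdecomp, hfull⟩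

end Skeleton

end HodgeStructure

end Literature.AlgebraicGeometry.Motives

end
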